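import Literature.Geometry.GaugeTheory.AdaptedFramesCanonicalSpinor
import HarnessLib

/-!
# Taubes's canonical connection `A₀` on `K⁻¹` of an almost complex `4`-manifold as a unitary
# connection (Taubes 1994, §1; Taubes 1995, §5 Step 1) — Čech form

Topic `Literature/Geometry/GaugeTheory`; continues `AdaptedFramesCanonicalSpinor` (for
`𝔞 : AdaptedFrames g o J ι` with `Spin^c` structure `𝔰 = 𝔞.toSpincStructure`: the canonical spinor
`u₀`, the local connection forms `A₀ᵢ = 𝔞.canonicalForm i` — real `1`-forms characterised by the
vanishing of the `I`-component of `∇̃_v u₀` and PROVED to satisfy the gauge law of a unitary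
connection on `det P̃ = K⁻¹` — and Taubes's torsion `b`).

C. H. Taubes, *The Seiberg–Witten invariants and symplectic forms*, Math. Res. Lett. 1 (1994), §1
(p. 810): "There is a unique connection `A₀` (up to gauge) on `K⁻¹` whose induced covariant
derivative `∇_{A₀}` on `S₊` has `∇_{A₀} ≅ 2⁻¹(1 + i·ω)∇_{A₀}` equal to the product covariant
derivative `d` on the summand `I` in `S₊`.  In particular, for this connection `A₀`, there is a
nontrivial section, `u₀`, of `I` which is annihilated by `∇_{A₀}`. … (1) `∇_{A₀} u₀ = b` …  The spinor
`u₀` solves the Dirac equation when `b · u₁ = 0`"; C. H. Taubes, *The Seiberg–Witten and Gromov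
invariants*, Math. Res. Lett. 2 (1995), §5 Step 1 (p. 233): "the bundle `K⁻¹` has a unique connection
(up to gauge equivalence), `A₀`, which is characterized as follows: the composition of the spin
covariant derivative with orthogonal projection onto the `I` summand in (5.1) defines a covariant
derivative, `∇_{A₀}`, on said summand which annihilates a nowhere-vanishing section."

## What this file adds (0 named facts)

The one analytic point left open in `AdaptedFramesCanonicalSpinor`: **the local forms `A₀ᵢ` are
smooth**, so that `A₀` IS a unitary connection on `det P̃` in the tree's sense
(`CircleCocycle.Connection`: smooth local real `1`-forms obeying the gauge law):

* `contMDiffAt_val_leviCivita_symmL`, `smoothAt_metricPairing_leviCivita` — for a `C^∞` vector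
  field `σ` on an open set `u ∋ x₀` and a vector field `W` smooth at `x₀`, the real `1`-form
  `v ↦ g(∇^{LC}_v σ, W)` is smooth at `x₀` (`RealOneForm.SmoothAt`, i.e. its chart representative is
  `C^∞`): the Levi-Civita connection of the `C^∞` metric `g` maps `C^∞` fields to `C^∞` sections of
  `Hom(TX, TX)` (the tree's `isLocallyContMDiff_leviCivita_holds`, Gallot–Hulin–Lafontaine
  Prop. 2.54), applied to the frame `e.symmL` of the tangent trivialization at `x₀` and paired with
  `W` through `g` (`contMDiffAt_val_apply`), then read in the chart at `x₀`, whose inverse has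
  derivative `e.symmL` (`TangentBundle.symmL_trivializationAt`);
* `AdaptedFrames.smoothAt_canonicalForm` — hence `A₀ᵢ = Σ_{k,l} c_{kl} g(∇^{LC} e^{(i)}_k, e^{(i)}_l)`
  is smooth on `U_i`;
* **`AdaptedFrames.canonicalConnection 𝔞 : 𝔞.toSpincStructure.detLineBundle.Connection`** — Taubes's
  `A₀`; PROVED: `∇̃^{A₀}_v u₀ = b_i(v) u₁` (Taubes's (1): the `I`-component of `∇̃^{A₀} u₀` vanishes,
  "`∇_{A₀}` … equal to … `d` on the summand `I`", `u₀` being constant), the **uniqueness** of `A₀`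
  among unitary connections on `det P̃` with this property (`form_eq_canonicalConnection_form`: equal
  local forms in every chart), and `∂_{A₀} u₀ = Σ_k b_i(e_k) γ_k u₁`, so that
  `∂_{A₀} u₀ = 0 ↔ b₀ = i b₁ ∧ b₂ = i b₃` (Taubes 1994, (3)).

Not here: Taubes's Lemma 1 (`∂_{A₀} u₀ = 0 ⟺ dω = 0` in the symplectic case).

## References

* C. H. Taubes, *The Seiberg–Witten invariants and symplectic forms*, Math. Res. Lett. 1 (1994)
  809–822, §1 (pp. 810–811, (1), (3)). [Taubes1994]
* C. H. Taubes, *The Seiberg–Witten and Gromov invariants*, Math. Res. Lett. 2 (1995) 221–238,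
  §5 Step 1 (p. 233). [Taubes1995]
* S. Gallot, D. Hulin, J. Lafontaine, *Riemannian Geometry*, 3rd ed. (2004), Prop. 2.54 (p. 70).
  [GallotHulinLafontaine2004]
* J. W. Morgan, *The Seiberg–Witten Equations and Applications to the Topology of Smooth
  Four-Manifolds*, Princeton Math. Notes 44 (1996), §3.2 (3.2), §3.3 (3.3). [MorganSWBook1996]
-/

noncomputable section

open scoped Manifold ContDiff Topology ComplexConjugate Matrix Bundle
open Set Function Complex Bundle
open Literature.Geometry.Lorentzian (PseudoRiemannianMetric contMDiffAt_clm_apply_iff)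
open Literature.Topology.FourManifolds (SmoothOrientation)

namespace Literature.Geometry.GaugeTheory

/-- Local notation: the model space `ℝ⁴`. -/
local notation "𝔼⁴" => EuclideanSpace ℝ (Fin 4)

/-! ### Smoothness of the `1`-forms `v ↦ g(∇^{LC}_v σ, W)` -/

section LeviCivitaForms

variable {X : Type*} [TopologicalSpace X] [ChartedSpace 𝔼⁴ X] [IsManifold (𝓡 4) ∞ X]
  (g : PseudoRiemannianMetric (𝓡 4) ∞ 𝔼⁴ (TangentSpace (𝓡 4) : X → Type _)) [g.HasLeviCivita]

/-- The frame field `x ↦ e.symmL x w` of the tangent trivialization `e` at `x₀` is smooth at `x₀`.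
[folklore] -/
theorem contMDiffAt_symmL_trivializationAt (x₀ : X) (w : 𝔼⁴) :
    ContMDiffAt (𝓡 4) ((𝓡 4).prod 𝓘(ℝ, 𝔼⁴)) ∞
      (fun x : X ↦ TotalSpace.mk' 𝔼⁴ (E := (TangentSpace (𝓡 4) : X → Type _)) x
        ((trivializationAt 𝔼⁴ (TangentSpace (𝓡 4) : X → Type _) x₀).symmL ℝ x w)) x₀ := by
  set e := trivializationAt 𝔼⁴ (TangentSpace (𝓡 4) : X → Type _) x₀ with he
  have hx₀e : x₀ ∈ e.baseSet := mem_baseSet_trivializationAt 𝔼⁴ (TangentSpace (𝓡 4) : X → Type _) x₀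
  set Y : 𝔼⁴ → Π x : X, TangentSpace (𝓡 4) x := fun v x ↦ e.symmL ℝ x v with hY
  have hX : ContMDiffOn (𝓡 4) ((𝓡 4).prod 𝓘(ℝ, 𝔼⁴)) ∞
      (fun x : X ↦ TotalSpace.mk' 𝔼⁴ (E := (TangentSpace (𝓡 4) : X → Type _)) x (Y w x)) e.baseSet := by
    rw [e.contMDiffOn_section_baseSet_iff]
    apply (contMDiffOn_const (c := w)).congr
    intro y hy
    simp [hY, hy]
  exact (hX x₀ hx₀e).contMDiffAt (e.open_baseSet.mem_nhds hx₀e)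

/-- **`x ↦ g_x(∇^{LC}_{Y_w} σ, W)` is smooth at `x₀`** for the coordinate frame `Y_w x = e.symmL x w` of
the tangent trivialization at `x₀`, a `C^∞` field `σ` on an open `u ∋ x₀` and a field `W` smooth at
`x₀`: the Levi-Civita connection of a `C^∞` metric takes `C^∞` fields to `C^∞` sections of
`Hom(TX, TX)` (Gallot–Hulin–Lafontaine 2004, Prop. 2.54; the tree's
`contMDiffAt_inCoordinates_leviCivita`). [cite: GallotHulinLafontaine2004, Prop. 2.54 (p. 70)] -/
theorem contMDiffAt_val_leviCivita_symmL {u : Set X} (hu : IsOpen u) {x₀ : X} (hx₀ : x₀ ∈ u)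
    {σ W : Π x : X, TangentSpace (𝓡 4) x}
    (hσ : ContMDiffOn (𝓡 4) ((𝓡 4).prod 𝓘(ℝ, 𝔼⁴)) ∞
      (fun x : X ↦ TotalSpace.mk' 𝔼⁴ (E := (TangentSpace (𝓡 4) : X → Type _)) x (σ x)) u)
    (hW : ContMDiffAt (𝓡 4) ((𝓡 4).prod 𝓘(ℝ, 𝔼⁴)) ∞
      (fun x : X ↦ TotalSpace.mk' 𝔼⁴ (E := (TangentSpace (𝓡 4) : X → Type _)) x (W x)) x₀) (w : 𝔼⁴) :
    ContMDiffAt (𝓡 4) 𝓘(ℝ, ℝ) ∞ (fun x ↦ g.val x (g.leviCivita σ x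
      ((trivializationAt 𝔼⁴ (TangentSpace (𝓡 4) : X → Type _) x₀).symmL ℝ x w)) (W x)) x₀ := by
  have htop : (((⊤ : ℕ∞) : ℕ∞ω) + 1) ≤ ∞ := by exact_mod_cast le_top
  have hLC : ContMDiffAt (𝓡 4) ((𝓡 4).prod 𝓘(ℝ, 𝔼⁴ →L[ℝ] 𝔼⁴)) ∞ (fun x ↦ TotalSpace.mk' (𝔼⁴ →L[ℝ] 𝔼⁴)
      (E := fun x : X ↦ TangentSpace (𝓡 4) x →L[ℝ] TangentSpace (𝓡 4) x) x (g.leviCivita σ x)) x₀ := by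
    rw [contMDiffAt_hom_bundle]
    exact ⟨contMDiffAt_id, g.contMDiffAt_inCoordinates_leviCivita ⊤ htop hu hx₀ (hσ.of_le htop)⟩
  have hA : ContMDiffAt (𝓡 4) ((𝓡 4).prod 𝓘(ℝ, 𝔼⁴)) ∞
      (fun x : X ↦ TotalSpace.mk' 𝔼⁴ (E := (TangentSpace (𝓡 4) : X → Type _)) x (g.leviCivita σ x
        ((trivializationAt 𝔼⁴ (TangentSpace (𝓡 4) : X → Type _) x₀).symmL ℝ x w))) x₀ :=
    hLC.clm_bundle_apply (contMDiffAt_symmL_trivializationAt x₀ w)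
  exact g.contMDiffAt_val_apply le_rfl hA hW

/-- **The real `1`-form `v ↦ g(∇^{LC}_v σ, W)` is smooth at `x₀`** (chart-wise, `RealOneForm.SmoothAt`),
for a `C^∞` field `σ` on an open `u ∋ x₀` and a field `W` smooth at `x₀`: its chart representative at
`x₀` is `y ↦ (w ↦ g(∇^{LC}_{e.symmL w} σ, W))(φ⁻¹ y)`, the inverse extended chart having derivative
`e.symmL` (`TangentBundle.symmL_trivializationAt`), and a family of linear functionals on `ℝ⁴` is
smooth iff its values are (`contMDiffAt_clm_apply_iff`). [cite: GallotHulinLafontaine2004, Prop. 2.54 (p. 70)] -/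
theorem smoothAt_metricPairing_leviCivita {u : Set X} (hu : IsOpen u) {x₀ : X} (hx₀ : x₀ ∈ u)
    {σ W : Π x : X, TangentSpace (𝓡 4) x}
    (hσ : ContMDiffOn (𝓡 4) ((𝓡 4).prod 𝓘(ℝ, 𝔼⁴)) ∞
      (fun x : X ↦ TotalSpace.mk' 𝔼⁴ (E := (TangentSpace (𝓡 4) : X → Type _)) x (σ x)) u)
    (hW : ContMDiffAt (𝓡 4) ((𝓡 4).prod 𝓘(ℝ, 𝔼⁴)) ∞
      (fun x : X ↦ TotalSpace.mk' 𝔼⁴ (E := (TangentSpace (𝓡 4) : X → Type _)) x (W x)) x₀) :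
    RealOneForm.SmoothAt (fun x ↦ metricPairing g x (g.leviCivita σ x) (W x)) x₀ := by
  set α : RealOneForm X := fun x ↦ metricPairing g x (g.leviCivita σ x) (W x) with hα
  -- the coordinate expression `F x w = α x (e.symmL x w)`
  set F : X → 𝔼⁴ →L[ℝ] ℝ := fun x ↦
    (α x).comp ((trivializationAt 𝔼⁴ (TangentSpace (𝓡 4) : X → Type _) x₀).symmL ℝ x) with hF_def
  have hF : ContMDiffAt (𝓡 4) 𝓘(ℝ, 𝔼⁴ →L[ℝ] ℝ) ∞ F x₀ := by
    rw [contMDiffAt_clm_apply_iff]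
    intro w
    exact contMDiffAt_val_leviCivita_symmL g hu hx₀ hσ hW w
  have hF' : ContDiffWithinAt ℝ ∞ (F ∘ (extChartAt (𝓡 4) x₀).symm) (range (𝓡 4)) (extChartAt (𝓡 4) x₀ x₀) := by
    have h2 := (contMDiffAt_iff.1 hF).2
    simpa using h2
  -- the chart representative of `α` is `ofSubsingleton ∘ F ∘ φ⁻¹` on the chart target
  have hev : ∀ y ∈ (extChartAt (𝓡 4) x₀).target, α.toMForm.inChart x₀ y =
      ContinuousAlternatingMap.ofSubsingleton ℝ 𝔼⁴ ℝ (0 : Fin 1) (F ((extChartAt (𝓡 4) x₀).symm y)) := by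
    intro y hy
    have hx : (extChartAt (𝓡 4) x₀).symm y ∈ (chartAt 𝔼⁴ x₀).source := by
      rw [← extChartAt_source (𝓡 4)]
      exact (extChartAt (𝓡 4) x₀).map_target hy
    have hD : mfderivWithin 𝓘(ℝ, 𝔼⁴) (𝓡 4) (extChartAt (𝓡 4) x₀).symm (range (𝓡 4)) y =
        (trivializationAt 𝔼⁴ (TangentSpace (𝓡 4) : X → Type _) x₀).symmL ℝ ((extChartAt (𝓡 4) x₀).symm y) := by
      rw [TangentBundle.symmL_trivializationAt hx, (extChartAt (𝓡 4) x₀).right_inv hy]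
    ext v
    simp only [Literature.Geometry.Kaehler.MForm.inChart_apply, RealOneForm.toMForm_apply, hD,
      ContinuousAlternatingMap.ofSubsingleton_apply_apply, hF_def, ContinuousLinearMap.comp_apply]
    rfl
  have hcomp : ContDiffWithinAt ℝ ∞
      (fun y ↦ ContinuousAlternatingMap.ofSubsingleton ℝ 𝔼⁴ ℝ (0 : Fin 1) (F ((extChartAt (𝓡 4) x₀).symm y)))
      (range (𝓡 4)) (extChartAt (𝓡 4) x₀ x₀) :=
    (ContinuousAlternatingMap.ofSubsingletonLIE (𝕜 := ℝ) (E := 𝔼⁴) (F := ℝ)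
      (0 : Fin 1)).toContinuousLinearEquiv.contDiff.contDiffAt.comp_contDiffWithinAt _ hF'
  unfold RealOneForm.SmoothAt
  refine hcomp.congr_of_eventuallyEq ?_ (hev _ (mem_extChartAt_target x₀))
  filter_upwards [extChartAt_target_mem_nhdsWithin x₀] with y hy using hev y hy

omit [IsManifold (𝓡 4) ∞ X] in
/-- Finite sums of real `1`-forms smooth at a point are smooth at the point. [folklore] -/
theorem RealOneForm.smoothAt_finset_sum {κ : Type*} (s : Finset κ) {f : κ → RealOneForm X} {x : X}
    (h : ∀ k ∈ s, (f k).SmoothAt x) : (∑ k ∈ s, f k).SmoothAt x := by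
  classical
  induction s using Finset.induction_on with
  | empty => simpa using RealOneForm.smoothAt_zero x
  | insert a s ha ih =>
    rw [Finset.sum_insert ha]
    exact (h a (Finset.mem_insert_self a s)).add (ih fun k hk ↦ h k (Finset.mem_insert_of_mem hk))

end LeviCivitaForms

/-! ### Taubes's connection `A₀` -/

section Bundle

variable {X : Type*} [TopologicalSpace X] [ChartedSpace 𝔼⁴ X] [IsManifold (𝓡 4) ∞ X]
  {g : PseudoRiemannianMetric (𝓡 4) ∞ 𝔼⁴ (TangentSpace (𝓡 4) : X → Type _)}
  {o : SmoothOrientation (𝓡 4) X} {J : Π x : X, TangentSpace (𝓡 4) x →ₗ[ℝ] TangentSpace (𝓡 4) x}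
  {ι : Type*}

namespace AdaptedFrames

variable (𝔞 : AdaptedFrames g o J ι) [g.HasLeviCivita]

/-- `A₀ᵢ` as a finite sum of the `1`-forms `v ↦ g(∇^{LC}_v e^{(i)}_k, e^{(i)}_l)`. [cite: Taubes1994, §1 (p. 810)] -/
theorem canonicalForm_eq_sum (i : ι) :
    𝔞.canonicalForm i = ∑ k : Fin 4, ∑ l : Fin 4, canonicalCoeff k l •
      (fun x ↦ metricPairing g x (g.leviCivita (𝔞.frame i k) x) (𝔞.frame i l x) : RealOneForm X) := by
  funext x
  simp only [canonicalForm, Finset.sum_apply, Pi.smul_apply]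

/-- **The local forms `A₀ᵢ` are smooth on `U_i`.** [cite: Taubes1994, §1 (p. 810)] -/
theorem smoothAt_canonicalForm (i : ι) {x : X} (hx : x ∈ 𝔞.baseSet i) : (𝔞.canonicalForm i).SmoothAt x := by
  have hframeAt : ∀ k, ContMDiffAt (𝓡 4) ((𝓡 4).prod 𝓘(ℝ, 𝔼⁴)) ∞
      (fun y : X ↦ TotalSpace.mk' 𝔼⁴ (E := (TangentSpace (𝓡 4) : X → Type _)) y (𝔞.frame i k y)) x :=
    fun k ↦ (𝔞.contMDiffOn_frame i k x hx).contMDiffAt ((𝔞.isOpen_baseSet i).mem_nhds hx)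
  rw [canonicalForm_eq_sum]
  refine RealOneForm.smoothAt_finset_sum _ fun k _ ↦ RealOneForm.smoothAt_finset_sum _ fun l _ ↦ ?_
  exact (smoothAt_metricPairing_leviCivita g (𝔞.isOpen_baseSet i) hx (𝔞.contMDiffOn_frame i k)
    (hframeAt l)).smul _

/-- **Taubes's canonical connection `A₀` on `det P̃ = K⁻¹`** of the `Spin^c` structure of adapted
frames: the unitary connection with local forms `A₀ᵢ = -2 Im dρ(ω̃^{(i)})_{u₀u₀}`
(`canonicalForm`), smooth (`smoothAt_canonicalForm`) and obeying the gauge law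
(`canonicalForm_gauge`) — "the composition of the spin covariant derivative with orthogonal
projection onto the `I` summand … annihilates a nowhere-vanishing section", `u₀`.
[cite: Taubes1994, §1 (p. 810)] [cite: Taubes1995, §5 Step 1 (p. 233)] -/
def canonicalConnection : 𝔞.toSpincStructure.detLineBundle.Connection where
  form := 𝔞.canonicalForm
  smoothAt_form i _ hx := 𝔞.smoothAt_canonicalForm i hx
  gauge i j _ hx v := 𝔞.canonicalForm_gauge i j hx v

/-- The local forms of `A₀` (definitional). [cite: Taubes1994, §1 (p. 810)] -/
@[simp] theorem canonicalConnection_form (i : ι) (x : X) (v : TangentSpace (𝓡 4) x) :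
    𝔞.canonicalConnection.form i x v = 𝔞.canonicalFormFun i x v :=
  𝔞.canonicalForm_apply i x v

/-- **Taubes's (1): `∇̃^{A₀}_v u₀ = b_i(v) u₁`** — the `I`-component of the `A₀`-covariant derivative
of `u₀` vanishes (the induced covariant derivative on `I` is the product derivative `d`, and `u₀` is
constant), the `K⁻¹`-component is the torsion `b`. [cite: Taubes1994, §1 (1)] -/
theorem covDeriv_canonicalConnection_canonicalSpinor (i : ι) (x : X) (v : TangentSpace (𝓡 4) x) :
    SpincStructure.covDeriv 𝔞.canonicalConnection 𝔞.canonicalSpinor i x v = 𝔞.canonicalTorsion i x v • detUnit :=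
  𝔞.covDeriv_canonicalSpinor_of_eq _ (𝔞.canonicalConnection_form i x v)

/-- The `I`-component of `∇̃^{A₀}_v u₀` vanishes ("`∇_{A₀}` … equal to the product covariant derivative
`d` on the summand `I`"). [cite: Taubes1994, §1 (p. 810)] -/
@[simp] theorem covDeriv_canonicalConnection_canonicalSpinor_inl_one (i : ι) (x : X) (v : TangentSpace (𝓡 4) x) :
    SpincStructure.covDeriv 𝔞.canonicalConnection 𝔞.canonicalSpinor i x v (Sum.inl 1) = 0 := by
  rw [covDeriv_canonicalConnection_canonicalSpinor, Pi.smul_apply, detUnit_inl_one, smul_zero]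

/-- **Uniqueness of `A₀`**: a unitary connection `A` on `det P̃` for which the `I`-component of `∇̃^A u₀`
vanishes on every chart has the local forms of `A₀` ("There is a unique connection `A₀` (up to gauge)
… "; here even the local forms agree, the `Spin^c` cocycle being fixed). [cite: Taubes1994, §1 (p. 810)] -/
theorem form_eq_canonicalConnection_form (A : 𝔞.toSpincStructure.detLineBundle.Connection)
    (hA : ∀ i x (v : TangentSpace (𝓡 4) x), SpincStructure.covDeriv A 𝔞.canonicalSpinor i x v (Sum.inl 1) = 0)
    (i : ι) (x : X) (v : TangentSpace (𝓡 4) x) :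
    A.form i x v = 𝔞.canonicalConnection.form i x v := by
  rw [canonicalConnection_form]
  exact (𝔞.covDeriv_canonicalSpinor_inl_one_eq_zero_iff A i x v).1 (hA i x v)

/-- **`∂_{A₀} u₀ = Σ_k b_i(e_k) γ_k u₁`** ("`e^ν b_ν`"). [cite: Taubes1994, §1 (p. 810)] -/
theorem dirac_canonicalConnection_canonicalSpinor (i : ι) (x : X) :
    SpincStructure.dirac 𝔞.canonicalConnection 𝔞.canonicalSpinor i x =
      ∑ k : Fin 4, 𝔞.canonicalTorsion i x (𝔞.frame i k x) • (cliffordBasis k *ᵥ detUnit) :=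
  𝔞.dirac_canonicalSpinor_of_forall _ fun v ↦ 𝔞.canonicalConnection_form i x v

/-- **`∂_{A₀} u₀ = 0 ↔ b₀ = i b₁ ∧ b₂ = i b₃`** at a point of the chart `i` (`b_k = b_i(e_k)`): `u₀` is
`A₀`-harmonic iff Taubes's torsion is of type `(0, 1)` (Taubes 1994, (3); his Lemma 1 identifies this
with `dω = 0` in the symplectic case). [cite: Taubes1994, §1 (3)] -/
theorem dirac_canonicalConnection_canonicalSpinor_eq_zero_iff (i : ι) (x : X) :
    SpincStructure.dirac 𝔞.canonicalConnection 𝔞.canonicalSpinor i x = 0 ↔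
      𝔞.canonicalTorsion i x (𝔞.frame i 0 x) = I * 𝔞.canonicalTorsion i x (𝔞.frame i 1 x) ∧
        𝔞.canonicalTorsion i x (𝔞.frame i 2 x) = I * 𝔞.canonicalTorsion i x (𝔞.frame i 3 x) :=
  𝔞.dirac_canonicalSpinor_eq_zero_iff _ fun v ↦ 𝔞.canonicalConnection_form i x v

end AdaptedFrames

end Bundle

end Literature.Geometry.GaugeTheory

end
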